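import Summits.BirchSwinnertonDyer.BirchSwinnertonDyer.Theorems.ClassRecordThreeEulerHalvesAtThreeAuxInertLevelOfChebotarev
import Summits.BirchSwinnertonDyer.BirchSwinnertonDyer.Theorems.ClassRecordThreeEulerHalvesAtThreeChebSupplyStub
import HarnessLib

/-!
# `stub_auxiliaryInertLevelAtThree` — the AUXILIARY INERT LEVEL of line `inert` (crux 19109) PROVED

Crux `stmt-BirchSwinnertonDyer-19109` (`EulerHalvesAtThree`), line `inert` (tam3-p1 g18).  The registered
stub `stub_auxiliaryInertLevelAtThree` (r17 signature verbatim = bsd-idea-9 g8's `AuxiliaryInertLevel W K ι 3 q N`: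
an auxiliary inert prime `ℓ₀ ∤ N m₀` with `3 ∤ a_{ℓ₀}(E)`, `σ^{ℓ₀+1} = 1` for the generator `σ` of
`Gal(K[ℓ₀m₀]/K[m₀])`, and `3^e ∣ #Stab_{⟨σ⟩}(w̃)` at every prime `w̃ ∣ q` of `K[ℓ₀m₀]`) is proved by composing

* `AuxInertLevel.stub_auxiliaryInertLevelAtThree_of_chebotarevSupply` (p648431: the reduction to the
  CHEBOTAREV SUPPLY — Galois side p646235, ideal side p647278), with
* `ChebSupply.stub_chebotarevSupplyAtThree` (`…ChebSupplyStub`: the Chebotarev supply itself — `GL₂(F_3)`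
  game p649893, action algebra p650478, Kummer generator p651463, order computation p651865, non-emptiness
  p652012, Frobenius dictionary p652633, density p653032, glue p653841).

* `stub_auxiliaryInertLevelAtThree` — **the registered stub**, signature verbatim.

HONEST FRAMING: closes ONE registered stub of ONE line of crux 19109 (skeleton r17/r19); the line's other
obligations (three citable bundles, the IMC-grade `stub_coStepLResidualShapeAtThree`,
`stub_x11aLowerHalfAtThree` = 19064@3) remain; nothing about BSD for any curve is proved here.

## References

* B. H. Gross, *Kolyvagin's work on modular elliptic curves*, in *L-functions and Arithmetic*, LMS Lecture
  Notes 153 (1991), §3 (pp. 238–239). [GrossLMS1991]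
* D. A. Cox, *Primes of the form x² + ny²*, 2nd ed. (2013), Thm. 7.24, (7.27), §9.A. [Cox2013]
* J. Neukirch, *Algebraic Number Theory* (1999), Ch. I (9.4), Ch. VII (13.4). [NeukirchANT1999]

## Mathlib / tree search

Tree: `AuxInertLevel.stub_auxiliaryInertLevelAtThree_of_chebotarevSupply` (p648431),
`ChebSupply.stub_chebotarevSupplyAtThree` (`…ChebSupplyStub`).  `lean search 'stub_auxiliaryInertLevelAtThree'`
(2026-08-28): only the skeleton and p648431.
-/

noncomputable section

set_option autoImplicit false
set_option linter.dupNamespace false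

open scoped nonZeroDivisors NumberField Pointwise Classical
open IsDedekindDomain IsDedekindDomain.HeightOneSpectrum Module NumberField WeierstrassCurve

namespace Summit.BirchSwinnertonDyer.BirchSwinnertonDyer.Theorems.AuxInertLevel

open Literature.NumberTheory.EllipticCurves
open Literature.NumberTheory.NumberFields Literature.NumberTheory.NumberFields.RingClassField
open Literature.NumberTheory.QuadraticFields.RingClass
open Literature.NumberTheory.EllipticCurves.Rank1Residual

/-- **`stub_auxiliaryInertLevelAtThree`** (registered signature verbatim; bsd-idea-9 g8's
`AuxiliaryInertLevel W K ι 3 q N`): for `E/ℚ` in global minimal form with `Surj W 3`, `K` imaginary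
quadratic with `d_K < -4`, a rational prime `q` split in `K`, `N ≠ 0`, every `e` and every square-free
`m₀` whose prime factors are inert and prime to `N`, there is an auxiliary prime `ℓ₀ ∤ N m₀`, inert in `K`,
with `3 ∤ a_{ℓ₀}(E)`, such that the generator `σ` of `Gal(K[ℓ₀m₀]/K[m₀])` satisfies `σ^{ℓ₀+1} = 1` and
`3^e` divides the order of the stabiliser in `⟨σ⟩` of every prime of `K[ℓ₀m₀]` above `q`.  Proof:
`stub_auxiliaryInertLevelAtThree_of_chebotarevSupply` (p648431) applied to the Chebotarev supply
`ChebSupply.stub_chebotarevSupplyAtThree`. [cite: GrossLMS1991, §3 (pp. 238–239)]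
[cite: Cox2013, Thm. 7.24, (7.27), §9.A] [cite: NeukirchANT1999, Ch. I (9.4), Ch. VII (13.4)] -/
theorem stub_auxiliaryInertLevelAtThree :
    ∀ (W : WeierstrassCurve ℚ) [W.IsElliptic] [W.IsGloballyMinimal] (K : Type) [Field K] [NumberField K] (ι : K →+* ℂ)
      [∀ j : ℕ, NumberField (ringClassField K ι j)],
      IsImaginaryQuadratic K → NumberField.discr K < -4 → Surj W 3 →
      ∀ (q N : ℕ) [Fact q.Prime], ((Ideal.span {(q : ℤ)}).primesOver (𝓞 K)).ncard = 2 → N ≠ 0 →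
      ∀ e m₀ : ℕ, Squarefree m₀ → (∀ r ∈ m₀.primeFactors, ¬ r ∣ N ∧ (Ideal.span {(r : 𝓞 K)}).IsPrime) →
        ∃ ℓ₀ : ℕ, ℓ₀.Prime ∧ ¬ ℓ₀ ∣ N ∧ ¬ ℓ₀ ∣ m₀ ∧ (Ideal.span {(ℓ₀ : 𝓞 K)}).IsPrime ∧
          ¬ (3 : ℤ) ∣ W.frobeniusTrace ℓ₀ ∧
          ∀ σ : ringClassField K ι (ℓ₀ * m₀) ≃ₐ[ℚ] ringClassField K ι (ℓ₀ * m₀),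
            Subgroup.zpowers σ = ringClassGalOver ι (ℓ₀ * m₀) m₀ →
            σ ^ (ℓ₀ + 1) = 1 ∧
            ∀ w : HeightOneSpectrum (𝓞 (ringClassField K ι (ℓ₀ * m₀))),
              ((q : ℕ) : 𝓞 (ringClassField K ι (ℓ₀ * m₀))) ∈ w.asIdeal →
              3 ^ e ∣ Nat.card (MulAction.stabilizer (Subgroup.zpowers σ) w.asIdeal) :=
  stub_auxiliaryInertLevelAtThree_of_chebotarevSupply
    Summit.BirchSwinnertonDyer.BirchSwinnertonDyer.Theorems.ChebSupply.stub_chebotarevSupplyAtThree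

end Summit.BirchSwinnertonDyer.BirchSwinnertonDyer.Theorems.AuxInertLevel

end
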